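import Summits.QuantumFields.YangMills.Theorems.UnitScaleTiltProp7StubEXOfChartPieces
import HarnessLib

/-!
# Route `UnitScaleTilt`, crux K1 child «MinimiserStabilityRegPr» (stmt-QuantumFields-19200), stub `stub_existenceMinimalOrbit` (EX), route (α) — **THE NUMERIC WINDOWS OF THE CHART
# PIECES QUANTIFIED**: the eight windows (W47) of ★w1's `Prop7ChartT3.chart47T3_of_regPr` and the nine windows (WS) of ★w5's `Prop7ChartSigmaT3OfRegPr.chartSigmaT3_of_regPr`
# (the displayed rows `hw47`∕`hwS` of `stubEX_of_chartPieces`, p601708) hold at EVERY member of EVERY `L` (no threshold `L₀`: the located (GEO-L5)-type sub-gap is EMPTY)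
# as soon as the per-`L` constants obey SEPARATED closed-form smallness: `α·L² ≤ 10⁻⁹`, `e·L² ≤ 10⁻⁹`, `L^{K−n}·b·L⁵ ≤ 10⁻¹⁰`, `4ε ≤ b`, `2·10⁹·B_H·(L^{K−n})²·ε ≤ 1`

Cell `ym3-torus`, width seat `ym-ust-19200-w2` (gen 2; OWNER 2026-08-28T03:26:35Z «NEXT SOCKET (you): (iii) the window-discharge lemma … give L₀ as a closed expression, and list
which members are NOT pure-L»).  THEOREMS ONLY (0 `def`, 0 `sorry`).  YM₃ on T³ is a ladder rung (R3), not the Clay problem; nothing here claims the stub, the crux, d = 4 or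
the mass gap.  `--supports stmt-QuantumFields-19200 --as helper`; count-neutral.

THE ANSWER (numbers).  At `d = 3`: `C0 3 = 226·(8·4·7)² = 11339776`, `c2′ 3 L = 1/(14336·L²)`, `c3 3 L = 1/(512·L)`, `θ_gen 3 L x = 89600·L⁴·x`, `C3Gen 3 L = 16·4·131072·16·L⁵ =
134217728·L⁵`, the exponential member is `exp(4·800·16·7·2α) = exp(716800·α)` (bounded by `1 + 2·716800α ≤ 3/2` for `716800α ≤ 1/4`, Mathlib `Real.abs_exp_sub_one_le`),
`C2K F n K α = 16777216·exp(716800α)·(L^{K−n})²`.  Hence: (145) `8·3·θ_gen(2α)·L⁻⁴ = 4300800·α ≤ 1` is `L`-FREE; (155)'s pure-`L` part `(2L−1)L⁻² + (1/8)L⁻²` is `≤ 5/9 + 1/72 < 1` for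
every odd `L ≥ 3` — so NO member is an obstruction in `L` alone (L₀ = 3 = every admissible `L`); the `L`-dependent members are (51)∕`c2′` (`8α ≤ 1/(14336L²)`), `c3`
(`4L^{K−n}b < 1/(512L)`, `2e ≤ 1/(512L)`), `C3Gen` in (155) and the member-dependent `L^{K−n}` in `b`, `(L^{K−n})²` in `C2K·ε` — ALL absorbed by the quantifier order of
19200's text (`∃ a₁′ O₁` AFTER `L`, BEFORE the member; the member-wise `b`, `ε` are auxiliary radii of Prop. 3's chart, not letters of the stub): choose `α = 10⁻⁹/L²`, `e = 10⁻⁹/L²`,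
`b = 10⁻¹⁰/(L⁵·L^{K−n})`, `ε = min(b/4, 1/(2·10⁹·B_H·(L^{K−n})²))`.

WHAT IS PROVED.  `three_le_L`, `d_cast`, `exp_member_le` (`exp(716800α) ≤ 3/2`), `w7_abstract`; ★ **`windows47_of_small`** (the conjunction `hw47` of `stubEX_of_chartPieces` at
one member, from the four separated smallness rows + signs) and ★ **`windowsS_of_small`** (the conjunction `hwS`), both stated VERBATIM in the `(F.P K).d`, `(F.P K).L` letters of the
source theorems — so `stubEX_of_chartPieces` is fed by `hw47 := fun L hL i => windows47_of_small i.1.1 i.1.2.1 i.1.2.2 …` and `hwS := fun L hL i => windowsS_of_small i.1.1 i.1.2.1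
i.1.2.2 …` under `α L·L² ≤ 10⁻⁹`, `ef L·L² ≤ 10⁻⁹`, `L^{K−n}·bf L i·L⁵ ≤ 10⁻¹⁰`, `4·εf L i ≤ bf L i`, `2·10⁹·BH L·(L^{K−n})²·εf L i ≤ 1` (closed forms above; EVERY `L > 1`, no `L₀`).
HONEST SCOPE: arithmetic only; the analytic rows (N06, (46), Prop. 4, (1.37), CHART-5+EL, (γ)-growth, Thm2TorusAt, and the size window `M(r + 2B₀α) < e`) stay displayed.

References: T. Bałaban, CMP 98 (1985) 17–51 [Balaban1985Averaging] ((51) p.26, Prop. 3 (122)–(126) p.36, (145)–(148) p.40, (155) p.42); CMP 102 (1985) 277–309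
[Balaban1985Variational] (Prop. 3 p.289); CMP 99 (1985) 75–102 [Balaban1985RegularSpaces] ((1.29) p.81).
-/

set_option autoImplicit false

noncomputable section

open scoped BigOperators Matrix.Norms.L2Operator Matrix

namespace Summit.QuantumFields.YangMills.Theorems.Prop7ChartWindows

open Literature.MathematicalPhysics.QuantumFieldTheory.Balaban1983to89
open Literature.MathematicalPhysics.QuantumFieldTheory.Balaban1983to89.T3ContinuumYM3Torus
open B7Prop2Explicit (C0 c2')
open B7Prop3Flat (c3)
open B7Prop5GeneralLevels (thetaGen C3Gen C1ppGen)
open Summit.QuantumFields.YangMills.Theorems.Prop7ChartT3 (C2K)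

/-! ## §1 Arithmetic of the letters at `d = 3` -/

section Arith

variable (F : T3Family) (n K : ℕ)

/-- `L ≥ 3` (odd and `> 1`), as a real number. [cite: Balaban1985UV3, (1)-(3) p.256] -/
theorem three_le_L : (3 : ℝ) ≤ ((F.P K).L : ℝ) := by
  have h1 := F.hL.2
  obtain ⟨c, hc⟩ := F.hL.1
  have : 3 ≤ F.L := by omega
  show (3 : ℝ) ≤ (F.L : ℝ)
  exact_mod_cast this

/-- `d = 3` as a real number. [cite: Balaban1985UV3, (1)-(3) p.256] -/
theorem d_cast : (((F.P K).d : ℕ) : ℝ) = 3 := by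
  rw [T3Family.P_d]; norm_num

/-- The exponential member: `exp(4·800·(d+1)²(d+4)·2α) ≤ 3/2` once `716800·α ≤ 1/4` (`|e^x − 1| ≤ 2|x|` for `|x| ≤ 1`). [cite: Balaban1985Averaging, (51) p.26] -/
theorem exp_member_le {α : ℝ} (hα0 : 0 ≤ α) (hα : 716800 * α ≤ 1 / 4) :
    Real.exp (4 * (800 * ((((F.P K).d : ℕ) : ℝ) + 1) ^ 2 * ((((F.P K).d : ℕ) : ℝ) + 4)) * (2 * α)) ≤ 3 / 2 := by
  rw [d_cast]
  have hx : 4 * (800 * ((3 : ℝ) + 1) ^ 2 * ((3 : ℝ) + 4)) * (2 * α) = 716800 * α := by ring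
  rw [hx]
  have h1 : |716800 * α| ≤ 1 := by rw [abs_of_nonneg (by positivity)]; linarith
  have h2 := Real.abs_exp_sub_one_le h1
  rw [abs_of_nonneg (by positivity : (0 : ℝ) ≤ 716800 * α)] at h2
  have h3 : Real.exp (716800 * α) - 1 ≤ 2 * (716800 * α) := le_trans (le_abs_self _) h2
  linarith

end Arith

/-- The (147)-type member in abstract form: `18·(16777216·E·P)·B_H·3·ε ≤ 1` from `E ≤ 3/2` and `2·10⁹·B_H·P·ε ≤ 1`. [folklore] -/
theorem w7_abstract {E P BH ε : ℝ} (hE : E ≤ 3 / 2) (hP0 : 0 ≤ P) (hBH : 0 ≤ BH) (hε0 : 0 ≤ ε) (hε2 : 2 * 10 ^ 9 * BH * P * ε ≤ 1) :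
    18 * (8 * (131072 * ((3 : ℝ) + 1) ^ 2) * E * P) * BH * 3 * 1 * ε ≤ 1 := by
  have hQ0 : 0 ≤ P * BH * ε := by positivity
  have hEQ : E * (P * BH * ε) ≤ 3 / 2 * (P * BH * ε) := mul_le_mul_of_nonneg_right hE hQ0
  have hr : 18 * (8 * (131072 * ((3 : ℝ) + 1) ^ 2) * E * P) * BH * 3 * 1 * ε = 905969664 * (E * (P * BH * ε)) := by ring
  have hq : 2 * 10 ^ 9 * BH * P * ε = 2 * 10 ^ 9 * (P * BH * ε) := by ring
  rw [hr]
  rw [hq] at hε2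
  linarith

/-! ## §2 (W47): the eight windows of `chart47T3_of_regPr` from separated smallness -/

section W47

variable (F : T3Family) (n K : ℕ)
set_option maxHeartbeats 400000 in
/-- ★ **(W47) FROM SEPARATED SMALLNESS** — the eight windows of `Prop7ChartT3.chart47T3_of_regPr` at `(a, b, ε, B₀) := (α, b, ε, B_H)`, VERBATIM, from `α·L² ≤ 10⁻⁹`,
`L^{K−n}·b·L⁵ ≤ 10⁻¹⁰`, `4ε ≤ b`, `2·10⁹·B_H·(L^{K−n})²·ε ≤ 1` (and signs).  No threshold in `L`. [cite: Balaban1985Averaging, (51) p.26, (145)–(148) p.40, (155) p.42; Balaban1985Variational, Prop. 3 p.289] -/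
theorem windows47_of_small {α b ε BH : ℝ} (hα0 : 0 < α) (hb0 : 0 < b) (hε0 : 0 ≤ ε) (hBH : 0 ≤ BH)
    (hα : α * ((F.P K).L : ℝ) ^ 2 ≤ 1 / 10 ^ 9) (hb : ((F.P K).L : ℝ) ^ (K - n) * b * ((F.P K).L : ℝ) ^ 5 ≤ 1 / 10 ^ 10)
    (hε1 : 4 * ε ≤ b) (hε2 : 2 * 10 ^ 9 * BH * (((F.P K).L : ℝ) ^ (K - n)) ^ 2 * ε ≤ 1) :
    C0 (F.P K).d * (2 * α) ≤ 1 / 3 ∧ 4 * (2 * α) ≤ c2' (F.P K).d (F.P K).L ∧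
      Real.exp (4 * (800 * ((((F.P K).d : ℕ) : ℝ) + 1) ^ 2 * ((((F.P K).d : ℕ) : ℝ) + 4)) * (2 * α))
        * (1 + 8 * (131072 * ((((F.P K).d : ℕ) : ℝ) + 1) ^ 2) * ((((F.P K).L : ℕ) : ℝ) ^ (K - n) * b)) ≤ 2 ∧
      4 * ((((F.P K).L : ℕ) : ℝ) ^ (K - n) * b) < c3 (F.P K).d (F.P K).L ∧
      8 * (F.P K).d * thetaGen (F.P K).d (F.P K).L (2 * α) * (((F.P K).L : ℕ) : ℝ)⁻¹ ^ 4 ≤ 1 ∧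
      (2 * (((F.P K).L : ℕ) : ℝ) - 1) * (((F.P K).L : ℕ) : ℝ)⁻¹ ^ 2
        + 2 * (F.P K).d * thetaGen (F.P K).d (F.P K).L (2 * α) * (((F.P K).L : ℕ) : ℝ)⁻¹ ^ 3
        + 1 / 8 * (1 + 2 * (F.P K).d * thetaGen (F.P K).d (F.P K).L (2 * α) * (((F.P K).L : ℕ) : ℝ)⁻¹ ^ 2
          + 2 * (F.P K).d * C3Gen (F.P K).d (F.P K).L * ((((F.P K).L : ℕ) : ℝ) ^ (K - n) * b))
          * (((F.P K).L : ℕ) : ℝ)⁻¹ ^ 2 ≤ 1 ∧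
      18 * C2K F n K α * BH * (F.P K).d * 1 * ε ≤ 1 ∧ 2 * ε ≤ b / 2 := by
  obtain ⟨Lr, hLr⟩ : ∃ Lr : ℝ, ((F.P K).L : ℝ) = Lr := ⟨_, rfl⟩
  have hL3 : (3 : ℝ) ≤ Lr := hLr ▸ three_le_L F K
  have hexp := exp_member_le F K hα0.le
  have hd : (((F.P K).d : ℕ) : ℝ) = 3 := d_cast F K
  have hdn : (F.P K).d = 3 := T3Family.P_d F K
  rw [hLr] at hα hb hε2
  have hL0 : (0 : ℝ) < Lr := by linarith
  have hL1 : (1 : ℝ) ≤ Lr := by linarith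
  have hLne : Lr ≠ 0 := hL0.ne'
  have hL2sq : (9 : ℝ) ≤ Lr ^ 2 := by nlinarith
  have hL5 : (243 : ℝ) ≤ Lr ^ 5 := by
    have := pow_le_pow_left₀ (by norm_num : (0 : ℝ) ≤ 3) hL3 5
    norm_num at this
    exact this
  have hLle5 : Lr ≤ Lr ^ 5 := by
    calc Lr = Lr ^ 1 := (pow_one Lr).symm
      _ ≤ Lr ^ 5 := pow_le_pow_right₀ hL1 (by norm_num)
  have hαs : α ≤ 1 / 10 ^ 9 := by
    have : α * 1 ≤ α * Lr ^ 2 := mul_le_mul_of_nonneg_left (by linarith) hα0.le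
    linarith
  have hexp' : Real.exp (4 * (800 * ((3 : ℝ) + 1) ^ 2 * ((3 : ℝ) + 4)) * (2 * α)) ≤ 3 / 2 := by
    have h := hexp (by linarith)
    rw [hd] at h
    exact h
  have hX0 : 0 ≤ Lr ^ (K - n) * b := by positivity
  have hX' : Lr ^ (K - n) * b ≤ 1 / 10 ^ 10 := by
    have : Lr ^ (K - n) * b * 1 ≤ Lr ^ (K - n) * b * Lr ^ 5 := mul_le_mul_of_nonneg_left (by linarith) hX0
    linarith
  have hXL : Lr ^ (K - n) * b * Lr ≤ 1 / 10 ^ 10 := le_trans (mul_le_mul_of_nonneg_left hLle5 hX0) hb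
  have hi0 : 0 ≤ Lr⁻¹ := inv_nonneg.2 hL0.le
  have hi : Lr⁻¹ ≤ 1 / 3 := by
    rw [inv_eq_one_div]; exact one_div_le_one_div_of_le (by norm_num) hL3
  have hi2 : Lr⁻¹ ^ 2 ≤ 1 / 9 := by nlinarith
  have hi3 : Lr⁻¹ ^ 3 ≤ 1 / 27 := by nlinarith
  refine ⟨?_, ?_, ?_, ?_, ?_, ?_, ?_, ?_⟩
  · -- w1: C0·2α ≤ 1/3
    unfold C0; rw [hd]; nlinarith
  · -- w2: 8α ≤ 1/(14336 L²)
    unfold c2'; rw [hd, hLr]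
    rw [le_div_iff₀ (by positivity)]
    nlinarith
  · -- w3: the exponential member
    rw [hLr, hd]
    have h1 : 1 + 8 * (131072 * ((3 : ℝ) + 1) ^ 2) * (Lr ^ (K - n) * b) ≤ 4 / 3 := by nlinarith
    have h0 : 0 ≤ 1 + 8 * (131072 * ((3 : ℝ) + 1) ^ 2) * (Lr ^ (K - n) * b) := by positivity
    calc Real.exp (4 * (800 * ((3 : ℝ) + 1) ^ 2 * ((3 : ℝ) + 4)) * (2 * α)) * (1 + 8 * (131072 * ((3 : ℝ) + 1) ^ 2) * (Lr ^ (K - n) * b))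
        ≤ (3 / 2) * (4 / 3) := mul_le_mul hexp' h1 h0 (by norm_num)
      _ = 2 := by norm_num
  · -- w4: 4X < 1/(512 L)
    unfold c3; rw [hd, hLr]
    rw [lt_div_iff₀ (by positivity)]
    have : 4 * (Lr ^ (K - n) * b) * (128 * ((3 : ℝ) + 1) * Lr) = 2048 * (Lr ^ (K - n) * b * Lr) := by ring
    rw [this]
    linarith
  · -- w5 (145): 4300800 α ≤ 1, L-free
    unfold thetaGen; rw [hdn, hLr]; push_cast
    have hL4 : Lr ^ (3 + 1) * Lr⁻¹ ^ 4 = 1 := by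
      rw [show (3 + 1 : ℕ) = 4 from rfl, ← mul_pow, mul_inv_cancel₀ hLne, one_pow]
    have : (8 : ℝ) * 3 * (3200 * (3 + 1) * (3 + 4) * Lr ^ (3 + 1) * (2 * α)) * Lr⁻¹ ^ 4 = 4300800 * α * (Lr ^ (3 + 1) * Lr⁻¹ ^ 4) := by ring
    rw [this, hL4, mul_one]
    linarith
  · -- w6 (155)
    unfold thetaGen C3Gen C1ppGen; rw [hdn, hLr]; push_cast
    have e3 : Lr ^ (3 + 1) * Lr⁻¹ ^ 3 = Lr := by
      rw [show (3 + 1 : ℕ) = 4 from rfl]; field_simp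
    have e2 : Lr ^ (3 + 1) * Lr⁻¹ ^ 2 = Lr ^ 2 := by
      rw [show (3 + 1 : ℕ) = 4 from rfl]; field_simp
    have hαL : α * Lr ≤ 1 / 10 ^ 9 := by
      have : α * Lr * 1 ≤ α * Lr * Lr := mul_le_mul_of_nonneg_left hL1 (by positivity)
      nlinarith
    have t1 : (2 * Lr - 1) * Lr⁻¹ ^ 2 ≤ 5 / 9 := by
      have : (2 * Lr - 1) * Lr⁻¹ ^ 2 = 2 * Lr⁻¹ - Lr⁻¹ ^ 2 := by field_simp
      rw [this]; nlinarith
    have t2 : (2 : ℝ) * 3 * (3200 * (3 + 1) * (3 + 4) * Lr ^ (3 + 1) * (2 * α)) * Lr⁻¹ ^ 3 ≤ 1 / 100 := by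
      have hr : (2 : ℝ) * 3 * (3200 * (3 + 1) * (3 + 4) * Lr ^ (3 + 1) * (2 * α)) * Lr⁻¹ ^ 3 = 1075200 * (α * (Lr ^ (3 + 1) * Lr⁻¹ ^ 3)) := by ring
      rw [hr, e3]
      linarith
    have t3 : (2 : ℝ) * 3 * (3200 * (3 + 1) * (3 + 4) * Lr ^ (3 + 1) * (2 * α)) * Lr⁻¹ ^ 2 ≤ 1 / 100 := by
      have hr : (2 : ℝ) * 3 * (3200 * (3 + 1) * (3 + 4) * Lr ^ (3 + 1) * (2 * α)) * Lr⁻¹ ^ 2 = 1075200 * (α * (Lr ^ (3 + 1) * Lr⁻¹ ^ 2)) := by ring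
      rw [hr, e2]
      linarith
    have t4 : (2 : ℝ) * 3 * (16 * (4 * (131072 * (3 + 1) ^ 2) * Lr ^ (3 + 2))) * (Lr ^ (K - n) * b) ≤ 1 / 10 := by
      have hr : (2 : ℝ) * 3 * (16 * (4 * (131072 * (3 + 1) ^ 2) * Lr ^ (3 + 2))) * (Lr ^ (K - n) * b) = 805306368 * (Lr ^ (K - n) * b * Lr ^ 5) := by
        rw [show (3 + 2 : ℕ) = 5 from rfl]; ring
      rw [hr]
      linarith
    have t3' : 0 ≤ (2 : ℝ) * 3 * (3200 * (3 + 1) * (3 + 4) * Lr ^ (3 + 1) * (2 * α)) * Lr⁻¹ ^ 2 := by positivity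
    have t4' : 0 ≤ (2 : ℝ) * 3 * (16 * (4 * (131072 * (3 + 1) ^ 2) * Lr ^ (3 + 2))) * (Lr ^ (K - n) * b) := by positivity
    have hsum : 1 + (2 : ℝ) * 3 * (3200 * (3 + 1) * (3 + 4) * Lr ^ (3 + 1) * (2 * α)) * Lr⁻¹ ^ 2
        + (2 : ℝ) * 3 * (16 * (4 * (131072 * (3 + 1) ^ 2) * Lr ^ (3 + 2))) * (Lr ^ (K - n) * b) ≤ 111 / 100 := by linarith only [t3, t4]
    have hsum0 : 0 ≤ 1 + (2 : ℝ) * 3 * (3200 * (3 + 1) * (3 + 4) * Lr ^ (3 + 1) * (2 * α)) * Lr⁻¹ ^ 2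
        + (2 : ℝ) * 3 * (16 * (4 * (131072 * (3 + 1) ^ 2) * Lr ^ (3 + 2))) * (Lr ^ (K - n) * b) :=
      add_nonneg (add_nonneg zero_le_one t3') t4'
    have t7 : (1 + (2 : ℝ) * 3 * (3200 * (3 + 1) * (3 + 4) * Lr ^ (3 + 1) * (2 * α)) * Lr⁻¹ ^ 2
        + (2 : ℝ) * 3 * (16 * (4 * (131072 * (3 + 1) ^ 2) * Lr ^ (3 + 2))) * (Lr ^ (K - n) * b)) * Lr⁻¹ ^ 2 ≤ (111 / 100) * (1 / 9) :=
      mul_le_mul hsum hi2 (pow_nonneg hi0 2) (by norm_num)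
    linarith only [t1, t2, t7]
  · -- w7: 18·C2K·BH·3·ε ≤ 1
    unfold C2K; rw [hd, hLr]
    exact w7_abstract hexp' (by positivity) hBH hε0 hε2
  · -- w8: 2ε ≤ b/2
    linarith only [hε1]

end W47



/-! ## §3 (WS): the nine windows of `chartSigmaT3_of_regPr` from separated smallness -/

section WS

variable (F : T3Family) (n K : ℕ)

/-- ★ **(WS) FROM SEPARATED SMALLNESS** — the nine windows of `Prop7ChartSigmaT3OfRegPr.chartSigmaT3_of_regPr` at `(ε₀, e) := (α, e)`, VERBATIM, from `α·L² ≤ 10⁻⁹` and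
`e·L² ≤ 10⁻⁹` (and signs).  No threshold in `L`. [cite: Balaban1985Averaging, (51) p.26, (77)–(87) pp.30–31; Balaban1985RegularSpaces, (1.29) p.81] -/
theorem windowsS_of_small {α e : ℝ} (hα0 : 0 < α) (he0 : 0 < e)
    (hα : α * ((F.P K).L : ℝ) ^ 2 ≤ 1 / 10 ^ 9) (he : e * ((F.P K).L : ℝ) ^ 2 ≤ 1 / 10 ^ 9) :
    C0 (F.P K).d * (2 * α) ≤ 1 / 3 ∧ 4 * (2 * α) ≤ c2' (F.P K).d (F.P K).L ∧ 2 * α ≤ 1 / 8 ∧ e ≤ 1 / 20 ∧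
      Real.exp (4 * (800 * ((((F.P K).d : ℕ) : ℝ) + 1) ^ 2 * ((((F.P K).d : ℕ) : ℝ) + 4)) * (2 * α))
        * (1 + 8 * (131072 * ((((F.P K).d : ℕ) : ℝ) + 1) ^ 2) * e) ≤ 2 ∧
      2 * e ≤ c3 (F.P K).d (F.P K).L ∧ 2048 * (((F.P K).d : ℕ) : ℝ) * e ≤ 1 ∧
      C0 (F.P K).d * (2 * α + 4 * e) ≤ 1 / 3 ∧ 2 * (2 * α + 4 * e) ≤ c2' (F.P K).d (F.P K).L := by
  obtain ⟨Lr, hLr⟩ : ∃ Lr : ℝ, ((F.P K).L : ℝ) = Lr := ⟨_, rfl⟩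
  have hL3 : (3 : ℝ) ≤ Lr := hLr ▸ three_le_L F K
  have hexp := exp_member_le F K hα0.le
  rw [hLr] at hα he
  have hL0 : (0 : ℝ) < Lr := by linarith
  have hL2sq : (9 : ℝ) ≤ Lr ^ 2 := by nlinarith
  have hαs : α ≤ 1 / 10 ^ 9 := by
    have : α * 1 ≤ α * Lr ^ 2 := mul_le_mul_of_nonneg_left (by linarith) hα0.le
    linarith
  have hes : e ≤ 1 / 10 ^ 9 := by
    have : e * 1 ≤ e * Lr ^ 2 := mul_le_mul_of_nonneg_left (by linarith) he0.le
    linarith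
  have hd : (((F.P K).d : ℕ) : ℝ) = 3 := d_cast F K
  have hexp' : Real.exp (4 * (800 * ((3 : ℝ) + 1) ^ 2 * ((3 : ℝ) + 4)) * (2 * α)) ≤ 3 / 2 := by
    have h := hexp (by linarith)
    rw [hd] at h
    exact h
  refine ⟨?_, ?_, by linarith, by linarith, ?_, ?_, ?_, ?_, ?_⟩
  · unfold C0; rw [hd]; nlinarith
  · unfold c2'; rw [hd, hLr]
    rw [le_div_iff₀ (by positivity)]
    nlinarith
  · rw [hd]
    have h1 : 1 + 8 * (131072 * ((3 : ℝ) + 1) ^ 2) * e ≤ 4 / 3 := by nlinarith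
    have h0 : 0 ≤ 1 + 8 * (131072 * ((3 : ℝ) + 1) ^ 2) * e := by positivity
    calc Real.exp (4 * (800 * ((3 : ℝ) + 1) ^ 2 * ((3 : ℝ) + 4)) * (2 * α)) * (1 + 8 * (131072 * ((3 : ℝ) + 1) ^ 2) * e)
        ≤ (3 / 2) * (4 / 3) := mul_le_mul hexp' h1 h0 (by norm_num)
      _ = 2 := by norm_num
  · unfold c3; rw [hd, hLr]
    rw [le_div_iff₀ (by positivity)]
    have hL1 : (1 : ℝ) ≤ Lr := by linarith
    have : e * Lr ≤ 1 / 10 ^ 9 := by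
      have : e * Lr * 1 ≤ e * Lr * Lr := mul_le_mul_of_nonneg_left hL1 (by positivity)
      nlinarith
    nlinarith
  · rw [hd]; nlinarith
  · unfold C0; rw [hd]; nlinarith
  · unfold c2'; rw [hd, hLr]
    rw [le_div_iff₀ (by positivity)]
    nlinarith

end WS

end Summit.QuantumFields.YangMills.Theorems.Prop7ChartWindows

end
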